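import Summits.CriticalPhenomena.PercolationContinuityZ3.Theorems.Transplant.SkelPhiFaceNumsYRun
import HarnessLib

/-!
# N1 ({±1} node), (F) inner route, part R5b-y′ (hp-8 g33): **THE TARGET CELL BOX ON THE LAST CORE FROM LINEAR FLOORS** — the fields
# `laLo…/LLO/LHI, hlastc, hL0–hL3, hglo, hghi` of `FaceRunNums3`/`faceRunNums3_x_mk` for the last core `N+1` of the tangential y′-run:
# a generic α–β′ correlation bound (`corr_bound_gen`), the core's box (`yRunSched_core_subset`) and its correlation bound `Bc`, and the four
# linear floors `FL1–FL4` placing the core's cell readings inside the arrival box `cen′ ± (b₀ − 2)` about the contact cell `z`.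
builds on p205010 (kernel theorem, internal audit signed; external expert review pending) — nothing in this file uses p205010; no claim about the open node.
Lane `prim-bschramm`, seat `prim-hp-8` (gen 33); helper file (`--supports stmt-CriticalPhenomena-4575 --as helper`).
* `Skelφ.corr_bound_gen`, `yBndC`, `yCoreLoS/HiS/LoT/HiT`, `yRunSched_core_subset_yCore`, `yCSLo/yCSHi`, `yCore_corr`, **`lastCore_target_of_floors`**.
[cite: KozmaNitzan2024, §4 Lemma 12 (pp. 23–25)] [cite: MartineauTassion2017, §4.1, §4.3 Lemma 4.2]
-/

namespace Summit.CriticalPhenomena.PercolationContinuityZ3.Theorems.Transplant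

namespace Skelφ

open Literature.Probability.Percolation Literature.Probability.LatticeModels
open ChainPlanar ChainPara
open TwoAxis.Para (modulus coarse lam0 lam1)

/-- **Generic α–β′ correlation bound**: `|m − k·v| ≤ dT` and `k·sLo − dS − 1 ≤ L ≤ k·sHi + dS + 1` give
`|mod·m − v·U·L| ≤ mod·dT + n·U·(2k + dS + 1)` (`nℓ − U + 1 ≤ mod ≤ nℓ`, `|v| ≤ n`, `0 ≤ k`). [cite: MartineauTassion2017, §4.1] -/
theorem corr_bound_gen {n ℓ : ℕ} (hn : 1 ≤ n) {h v mod : ℤ} (hv : |v| ≤ n) (hmod0 : 0 < mod)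
    (hmodlo : (n : ℤ) * ℓ - (shearUnit n h : ℤ) + 1 ≤ mod) (hmodhi : mod ≤ (n : ℤ) * ℓ) {k dT dS m L : ℤ} (hk : 0 ≤ k)
    (hm : |m - k * v| ≤ dT) (hL1 : k * (((n : ℤ) * ℓ - (shearUnit n h : ℕ) + 1) / (shearUnit n h : ℕ)) - dS - 1 ≤ L)
    (hL2 : L ≤ k * ((n : ℤ) * ℓ / (shearUnit n h : ℕ) + 1) + dS + 1) :
    |mod * m - v * ((shearUnit n h : ℤ) * L)| ≤ mod * dT + (n : ℤ) * (shearUnit n h : ℤ) * (2 * k + dS + 1) := by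
  have hU0 : 0 < (shearUnit n h : ℤ) := shearUnit_pos hn h
  have hn0 : (0 : ℤ) < n := by exact_mod_cast hn
  have hs2 : mod - 2 * (shearUnit n h : ℤ) + 2 ≤ (shearUnit n h : ℤ) * (((n : ℤ) * ℓ - (shearUnit n h : ℕ) + 1) / (shearUnit n h : ℕ)) := by
    have := Int.lt_ediv_add_one_mul_self ((n : ℤ) * ℓ - (shearUnit n h : ℕ) + 1) hU0
    have e : (((n : ℤ) * ℓ - (shearUnit n h : ℕ) + 1) / (shearUnit n h : ℕ) + 1) * (shearUnit n h : ℤ) =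
        (shearUnit n h : ℤ) * (((n : ℤ) * ℓ - (shearUnit n h : ℕ) + 1) / (shearUnit n h : ℕ)) + shearUnit n h := by ring
    linarith
  have hs4 : (shearUnit n h : ℤ) * ((n : ℤ) * ℓ / (shearUnit n h : ℕ) + 1) ≤ mod + 2 * (shearUnit n h : ℤ) - 1 := by
    have := Int.ediv_mul_le ((n : ℤ) * ℓ) hU0.ne'
    have e : (shearUnit n h : ℤ) * ((n : ℤ) * ℓ / (shearUnit n h : ℕ) + 1) = (n : ℤ) * ℓ / (shearUnit n h : ℕ) * (shearUnit n h : ℤ) + shearUnit n h := by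
      ring
    linarith
  set U : ℤ := (shearUnit n h : ℤ) with hU
  set sLo : ℤ := ((n : ℤ) * ℓ - (shearUnit n h : ℕ) + 1) / (shearUnit n h : ℕ) with hsLo
  set sHi : ℤ := (n : ℤ) * ℓ / (shearUnit n h : ℕ) + 1 with hsHi
  have hks1 : k * (mod - 2 * U + 2) ≤ k * (U * sLo) := mul_le_mul_of_nonneg_left hs2 hk
  have hks2 : k * (U * sHi) ≤ k * (mod + 2 * U - 1) := mul_le_mul_of_nonneg_left hs4 hk
  have h1 : U * (k * sLo - dS - 1) ≤ U * L := mul_le_mul_of_nonneg_left hL1 hU0.le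
  have h2 : U * L ≤ U * (k * sHi + dS + 1) := mul_le_mul_of_nonneg_left hL2 hU0.le
  have e1 : U * (k * sLo - dS - 1) = k * (U * sLo) - U * dS - U := by ring
  have e2 : U * (k * sHi + dS + 1) = k * (U * sHi) + U * dS + U := by ring
  have e3 : k * (mod - 2 * U + 2) = k * mod - 2 * (k * U) + 2 * k := by ring
  have e4 : k * (mod + 2 * U - 1) = k * mod + 2 * (k * U) - k := by ring
  have e5 : U * (2 * k + dS + 1) = 2 * (k * U) + U * dS + U := by ring
  have hUL : |U * L - k * mod| ≤ U * (2 * k + dS + 1) := by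
    rw [abs_le]; constructor <;> linarith
  have e : mod * m - v * (U * L) = mod * (m - k * v) - v * (U * L - k * mod) := by ring
  rw [e]
  have hA : |mod * (m - k * v)| ≤ mod * dT := by
    rw [abs_mul, abs_of_pos hmod0]; exact mul_le_mul_of_nonneg_left hm hmod0.le
  have hB : |v * (U * L - k * mod)| ≤ (n : ℤ) * (U * (2 * k + dS + 1)) := by
    rw [abs_mul]; exact mul_le_mul hv hUL (abs_nonneg _) hn0.le
  calc |mod * (m - k * v) - v * (U * L - k * mod)| ≤ |mod * (m - k * v)| + |v * (U * L - k * mod)| := abs_sub _ _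
    _ ≤ mod * dT + (n : ℤ) * (U * (2 * k + dS + 1)) := add_le_add hA hB
    _ = mod * dT + (n : ℤ) * U * (2 * k + dS + 1) := by ring

/-- **The correlation bound of the last core** `k = N+1`: `Bc = mod·(2n + k·R′) + n·U·(2k + q + k·R′ + 1)`. [this work] -/
def yBndC (n : ℕ) (h mod : ℤ) (q R' : ℕ) (k : ℕ) : ℤ :=
  mod * (2 * (n : ℤ) + (k : ℤ) * R') + (n : ℤ) * (shearUnit n h : ℤ) * (2 * (k : ℤ) + q + (k : ℤ) * R' + 1)

/-- Along ends of core `k`: `k·sLo − q − k·R′`, `k·sHi + q + k·R′`; transverse ends `k·v − ((n+v) + k·R′)`, `k·v + (n−v) + k·R′`. [folklore] -/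
def yCoreLoS (n ℓ : ℕ) (h : ℤ) (q R' : ℕ) (k : ℕ) : ℤ := (k : ℤ) * (((n : ℤ) * ℓ - (shearUnit n h : ℕ) + 1) / (shearUnit n h : ℕ)) - q - (k : ℤ) * R'
/-- see `yCoreLoS`. [folklore] -/
def yCoreHiS (n ℓ : ℕ) (h : ℤ) (q R' : ℕ) (k : ℕ) : ℤ := (k : ℤ) * ((n : ℤ) * ℓ / (shearUnit n h : ℕ) + 1) + q + (k : ℤ) * R'
/-- see `yCoreLoS`. [folklore] -/
def yCoreLoT (n : ℕ) (v : ℤ) (R' : ℕ) (k : ℕ) : ℤ := (k : ℤ) * v - ((((n : ℤ) + v).toNat : ℕ) + (k : ℤ) * R')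
/-- see `yCoreLoS`. [folklore] -/
def yCoreHiT (n : ℕ) (v : ℤ) (R' : ℕ) (k : ℕ) : ℤ := (k : ℤ) * v + ((((n : ℤ) - v).toNat : ℕ) + (k : ℤ) * R')

/-- The core `k` inside its box. [folklore] -/
theorem yRunSched_core_subset_yCore {n ℓ : ℕ} {h v : ℤ} (hn : 1 ≤ n) (hv : |v| ≤ n) (hlay : (n + h.natAbs : ℕ) ≤ (n : ℤ) * ℓ + 1)
    (R' q N k : ℕ) :
    (yRunSched hn hv hlay R' q N).core k ⊆
      Finset.Icc (pt (yCoreLoS n ℓ h q R' k) (yCoreLoT n v R' k)) (pt (yCoreHiS n ℓ h q R' k) (yCoreHiT n v R' k)) :=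
  yRunSched_core_subset hn hv hlay R' q N k

/-- Signed level ends of the core. [folklore] -/
def yCSLo (n ℓ : ℕ) (h : ℤ) (q R' : ℕ) (τ : ℤ) (k : ℕ) : ℤ := min (τ * yCoreLoS n ℓ h q R' k) (τ * yCoreHiS n ℓ h q R' k)
/-- see `yCSLo`. [folklore] -/
def yCSHi (n ℓ : ℕ) (h : ℤ) (q R' : ℕ) (τ : ℤ) (k : ℕ) : ℤ := max (τ * yCoreLoS n ℓ h q R' k) (τ * yCoreHiS n ℓ h q R' k)

/-- **The correlation bound on the last core** (signed): for `m ∈ {min,max}(τ·yCoreLoT, τ·yCoreHiT)` and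
`L ∈ [min(τ·yCoreLoS, τ·yCoreHiS) − 1, max(…) + 1]`, `|mod·m − v·U·L| ≤ Bc_k`. [cite: MartineauTassion2017, §4.1] -/
theorem yCore_corr {n ℓ : ℕ} (hn : 1 ≤ n) {h v mod : ℤ} (hv : |v| ≤ n) (hmod0 : 0 < mod) (hmodlo : (n : ℤ) * ℓ - (shearUnit n h : ℤ) + 1 ≤ mod)
    (hmodhi : mod ≤ (n : ℤ) * ℓ) {τ : ℤ} (hτ : τ = 1 ∨ τ = -1) (q R' k : ℕ) {m : ℤ}
    (hm1 : min (τ * yCoreLoT n v R' k) (τ * yCoreHiT n v R' k) ≤ m) (hm2 : m ≤ max (τ * yCoreLoT n v R' k) (τ * yCoreHiT n v R' k)) {L : ℤ}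
    (hL1 : min (τ * yCoreLoS n ℓ h q R' k) (τ * yCoreHiS n ℓ h q R' k) - 1 ≤ L)
    (hL2 : L ≤ max (τ * yCoreLoS n ℓ h q R' k) (τ * yCoreHiS n ℓ h q R' k) + 1) :
    |mod * m - v * ((shearUnit n h : ℤ) * L)| ≤ yBndC n h mod q R' k := by
  have hvv := abs_le.1 hv
  have hk0 : (0 : ℤ) ≤ k := by positivity
  have hkR : (0 : ℤ) ≤ (k : ℤ) * R' := by positivity
  have hq0 : (0 : ℤ) ≤ q := by positivity
  have hU0 : 0 < (shearUnit n h : ℤ) := shearUnit_pos hn h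
  have hT : yCoreLoT n v R' k ≤ yCoreHiT n v R' k := by
    unfold yCoreLoT yCoreHiT
    rw [Int.toNat_of_nonneg (by linarith : (0 : ℤ) ≤ (n : ℤ) + v), Int.toNat_of_nonneg (by linarith : (0 : ℤ) ≤ (n : ℤ) - v)]
    linarith
  have hS : yCoreLoS n ℓ h q R' k ≤ yCoreHiS n ℓ h q R' k := by
    unfold yCoreLoS yCoreHiS
    have : ((n : ℤ) * ℓ - (shearUnit n h : ℕ) + 1) / (shearUnit n h : ℕ) ≤ (n : ℤ) * ℓ / (shearUnit n h : ℕ) := Int.ediv_le_ediv hU0 (by linarith)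
    have := mul_le_mul_of_nonneg_left this hk0
    linarith
  have hTlo : ∀ m', yCoreLoT n v R' k ≤ m' → m' ≤ yCoreHiT n v R' k → |m' - (k : ℤ) * v| ≤ 2 * (n : ℤ) + (k : ℤ) * R' := by
    intro m' h1 h2
    unfold yCoreLoT at h1; unfold yCoreHiT at h2
    rw [Int.toNat_of_nonneg (by linarith : (0 : ℤ) ≤ (n : ℤ) + v)] at h1
    rw [Int.toNat_of_nonneg (by linarith : (0 : ℤ) ≤ (n : ℤ) - v)] at h2
    rw [abs_le]; constructor <;> linarith
  have e : yBndC n h mod q R' k = mod * (2 * (n : ℤ) + (k : ℤ) * R') + (n : ℤ) * (shearUnit n h : ℤ) * (2 * (k : ℤ) + ((q : ℤ) + (k : ℤ) * R') + 1) := by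
    unfold yBndC; ring
  rw [e]
  rcases hτ with rfl | rfl
  · simp only [one_mul] at hm1 hm2 hL1 hL2
    rw [min_eq_left hT] at hm1; rw [max_eq_right hT] at hm2; rw [min_eq_left hS] at hL1; rw [max_eq_right hS] at hL2
    unfold yCoreLoS at hL1; unfold yCoreHiS at hL2
    exact corr_bound_gen hn hv hmod0 hmodlo hmodhi hk0 (hTlo m hm1 hm2) (by linarith) (by linarith)
  · simp only [neg_one_mul] at hm1 hm2 hL1 hL2
    rw [min_eq_right (neg_le_neg hT)] at hm1; rw [max_eq_left (neg_le_neg hT)] at hm2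
    rw [min_eq_right (neg_le_neg hS)] at hL1; rw [max_eq_left (neg_le_neg hS)] at hL2
    unfold yCoreHiS at hL1; unfold yCoreLoS at hL2
    have key := corr_bound_gen hn hv hmod0 hmodlo hmodhi hk0 (dS := (q : ℤ) + (k : ℤ) * R') (hTlo (-m) (by linarith) (by linarith))
      (L := -L) (by linarith) (by linarith)
    have e' : mod * m - v * ((shearUnit n h : ℤ) * L) = -(mod * -m - v * ((shearUnit n h : ℤ) * -L)) := by ring
    rw [e', abs_neg]; exact key

/-- **THE TARGET CELL BOX ON THE LAST CORE FROM LINEAR FLOORS** (x-face: along cells on axis `0`): the fields `laLo…/LLO/LHI, hlastc, hL0–hL3,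
hglo, hghi` of `FaceRunNums3`/`faceRunNums3_x_mk` for the last core `N+1` of the tangential y′-run read with sign `τ` at `yT` (cell readings
`f₀, f₁`), the contact cell `z`, the arrival centre `cen′` and box `b₀`, from four linear floors `FL1–FL4` (`Bc = yBndC … (N+1)`).
[cite: KozmaNitzan2024, §4 Lemma 12 (pp. 23–25)] -/
theorem lastCore_target_of_floors {A vα vβ c₀ c₁ D κ₀ κ₁ mod : ℤ} {n : ℕ} (hn : 1 ≤ n) {h : ℤ} (hA : 0 < A) (hκ₀ : 0 ≤ κ₀)
    (hc0 : c₀ = A * κ₀) (hc1 : c₁ = A * κ₁) (hmod : modulus n h vα vβ = mod) (hmod0 : 0 < mod) (hD : D = A ^ 2 * mod) (hv : |vα| ≤ n)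
    {ℓ : ℕ} (hlay : (n + h.natAbs : ℕ) ≤ (n : ℤ) * ℓ + 1) (hmodlo : (n : ℤ) * ℓ - (shearUnit n h : ℤ) + 1 ≤ mod) (hmodhi : mod ≤ (n : ℤ) * ℓ)
    (yT : Site 2) {τ : ℤ} (hτ : τ = 1 ∨ τ = -1) (R' q N : ℕ) (z cen' : Site 2) (b₀ : Fin 2 → ℕ)
    (FL1 : (n : ℤ) * mod * (cen' 0 - b₀ 0 + 2 - z 0 - coarse c₀ (D / 2) D (lam0 A vα vβ yT)) ≤ -(κ₀ * (yBndC n h mod q R' (N + 1) + 2 * n)) - n * mod)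
    (FL2 : (n : ℤ) * mod * (coarse c₀ (D / 2) D (lam0 A vα vβ yT) + 1) + κ₀ * (yBndC n h mod q R' (N + 1) + n) ≤ n * mod * (cen' 0 + b₀ 0 - 2 - z 0))
    (FL3 : mod * (cen' 1 - b₀ 1 + 2 - z 1 - coarse c₁ (D / 2) D (lam1 A n h yT)) ≤
      κ₁ * ((shearUnit n h : ℤ) * (yCSLo n ℓ h q R' τ (N + 1) - 1)) - mod + 1)
    (FL4 : mod * (coarse c₁ (D / 2) D (lam1 A n h yT) + 1) + κ₁ * ((shearUnit n h : ℤ) * yCSHi n ℓ h q R' τ (N + 1) + shearUnit n h - 1) ≤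
      mod * (cen' 1 + b₀ 1 - 2 - z 1)) :
    ∃ (LLO LHI : Site 2),
      (yRunSched hn hv hlay R' q N).core (N + 1) ⊆ Finset.Icc (pt (yCoreLoS n ℓ h q R' (N + 1)) (yCoreLoT n vα R' (N + 1)))
        (pt (yCoreHiS n ℓ h q R' (N + 1)) (yCoreHiT n vα R' (N + 1))) ∧
      LLO 0 ≤ coarse c₀ (D / 2) D (lam0 A vα vβ yT) +
        (c₀ * (A * (modulus n h vα vβ * (min (τ * yCoreLoT n vα R' (N + 1)) (τ * yCoreHiT n vα R' (N + 1))) -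
          max (vα * ((shearUnit n h : ℤ) * (min (τ * yCoreLoS n ℓ h q R' (N + 1)) (τ * yCoreHiS n ℓ h q R' (N + 1)) - 1))) (vα * ((shearUnit n h : ℤ) * (max (τ * yCoreLoS n ℓ h q R' (N + 1)) (τ * yCoreHiS n ℓ h q R' (N + 1))) + shearUnit n h - 1))) / n)) / D ∧
      coarse c₀ (D / 2) D (lam0 A vα vβ yT) +
        (c₀ * (A * (modulus n h vα vβ * (max (τ * yCoreLoT n vα R' (N + 1)) (τ * yCoreHiT n vα R' (N + 1))) -
          min (vα * ((shearUnit n h : ℤ) * (min (τ * yCoreLoS n ℓ h q R' (N + 1)) (τ * yCoreHiS n ℓ h q R' (N + 1)) - 1))) (vα * ((shearUnit n h : ℤ) * (max (τ * yCoreLoS n ℓ h q R' (N + 1)) (τ * yCoreHiS n ℓ h q R' (N + 1))) + shearUnit n h - 1))) / n)) / D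
        + 1 ≤ LHI 0 ∧
      LLO 1 ≤ coarse c₁ (D / 2) D (lam1 A n h yT) + (c₁ * (A * ((shearUnit n h : ℤ) * (min (τ * yCoreLoS n ℓ h q R' (N + 1)) (τ * yCoreHiS n ℓ h q R' (N + 1)) - 1)))) / D ∧
      coarse c₁ (D / 2) D (lam1 A n h yT) + (c₁ * (A * ((shearUnit n h : ℤ) * (max (τ * yCoreLoS n ℓ h q R' (N + 1)) (τ * yCoreHiS n ℓ h q R' (N + 1))) + shearUnit n h - 1))) / D + 1 ≤ LHI 1 ∧
      (∀ i, cen' i - b₀ i + 2 ≤ LLO i + z i) ∧ (∀ i, LHI i + z i ≤ cen' i + b₀ i - 2) := by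
  set f₀ := coarse c₀ (D / 2) D (lam0 A vα vβ yT) with hf₀
  set f₁ := coarse c₁ (D / 2) D (lam1 A n h yT) with hf₁
  set U : ℤ := (shearUnit n h : ℤ) with hU
  have hn0 : (0 : ℤ) < n := by exact_mod_cast hn
  have hnm : 0 < (n : ℤ) * mod := mul_pos hn0 hmod0
  set cLS := yCoreLoS n ℓ h q R' (N + 1)
  set cHS := yCoreHiS n ℓ h q R' (N + 1)
  set cLT := yCoreLoT n vα R' (N + 1)
  set cHT := yCoreHiT n vα R' (N + 1)
  have hmsMs : min (τ * cLS) (τ * cHS) ≤ max (τ * cLS) (τ * cHS) + 1 := by linarith [min_le_max (a := τ * cLS) (b := τ * cHS)]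
  have hcorr : ∀ m : ℤ, (m = min (τ * cLT) (τ * cHT) ∨ m = max (τ * cLT) (τ * cHT)) →
      ∀ L : ℤ, min (τ * cLS) (τ * cHS) - 1 ≤ L → L ≤ max (τ * cLS) (τ * cHS) + 1 → |mod * m - vα * (U * L)| ≤ yBndC n h mod q R' (N + 1) := by
    intro m hm L hL1 hL2
    refine yCore_corr hn hv hmod0 hmodlo hmodhi hτ q R' (N + 1) ?_ ?_ hL1 hL2
    · rcases hm with rfl | rfl
      · exact le_rfl
      · exact min_le_max
    · rcases hm with rfl | rfl
      · exact min_le_max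
      · exact le_rfl
  let X0lo : ℤ := (c₀ * (A * (modulus n h vα vβ * (min (τ * cLT) (τ * cHT)) -
      max (vα * (U * (min (τ * cLS) (τ * cHS) - 1))) (vα * (U * (max (τ * cLS) (τ * cHS)) + U - 1))) / n)) / D
  let X0hi : ℤ := (c₀ * (A * (modulus n h vα vβ * (max (τ * cLT) (τ * cHT)) -
      min (vα * (U * (min (τ * cLS) (τ * cHS) - 1))) (vα * (U * (max (τ * cLS) (τ * cHS)) + U - 1))) / n)) / D
  let X1lo : ℤ := (c₁ * (A * (U * (min (τ * cLS) (τ * cHS) - 1)))) / D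
  let X1hi : ℤ := (c₁ * (A * (U * (max (τ * cLS) (τ * cHS)) + U - 1))) / D
  have hlo0 := (read0_corr_lo_bounds (U := U) hA hκ₀ hmod0 hn0 hc0 hD hv hmsMs (hcorr _ (Or.inl rfl))).1
  have hhi0 := (read0_corr_hi_bounds (U := U) hA hκ₀ hmod0 hn0 hc0 hD hv hmsMs (hcorr _ (Or.inr rfl))).2
  obtain ⟨⟨hlo1, -⟩, -, hhi1⟩ := read1_gen_bounds (U := U) (κ₁ := κ₁) hA hmod0 hc1 hD (min (τ * cLS) (τ * cHS)) (max (τ * cLS) (τ * cHS))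
  simp only [yCSLo, yCSHi] at FL3 FL4
  refine ⟨pt (f₀ + X0lo) (f₁ + X1lo), pt (f₀ + X0hi + 1) (f₁ + X1hi + 1),
    yRunSched_core_subset_yCore hn hv hlay R' q N (N + 1), le_of_eq (pt_zero _ _), le_of_eq (pt_zero _ _).symm,
    le_of_eq (pt_one _ _), le_of_eq (pt_one _ _).symm, ?_, ?_⟩
  · intro i; fin_cases i
    · show cen' 0 - b₀ 0 + 2 ≤ (pt (f₀ + X0lo) (f₁ + X1lo)) 0 + z 0
      rw [pt_zero]
      have e : X0lo = (c₀ * (A * (mod * (min (τ * cLT) (τ * cHT)) -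
          max (vα * (U * (min (τ * cLS) (τ * cHS) - 1))) (vα * (U * (max (τ * cLS) (τ * cHS)) + U - 1))) / n)) / D := by
        simp only [X0lo, hmod]
      have : cen' 0 - b₀ 0 + 2 - z 0 ≤ f₀ + X0lo := by
        rw [e]; exact le_of_mul_le_mul_left (by linarith) hnm
      linarith
    · show cen' 1 - b₀ 1 + 2 ≤ (pt (f₀ + X0lo) (f₁ + X1lo)) 1 + z 1
      rw [pt_one]
      have : cen' 1 - b₀ 1 + 2 - z 1 ≤ f₁ + X1lo := le_of_mul_le_mul_left (by simp only [X1lo]; linarith) hmod0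
      linarith
  · intro i; fin_cases i
    · show (pt (f₀ + X0hi + 1) (f₁ + X1hi + 1)) 0 + z 0 ≤ cen' 0 + b₀ 0 - 2
      rw [pt_zero]
      have e : X0hi = (c₀ * (A * (mod * (max (τ * cLT) (τ * cHT)) -
          min (vα * (U * (min (τ * cLS) (τ * cHS) - 1))) (vα * (U * (max (τ * cLS) (τ * cHS)) + U - 1))) / n)) / D := by
        simp only [X0hi, hmod]
      have : f₀ + X0hi + 1 ≤ cen' 0 + b₀ 0 - 2 - z 0 := by
        rw [e]; exact le_of_mul_le_mul_left (by linarith) hnm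
      linarith
    · show (pt (f₀ + X0hi + 1) (f₁ + X1hi + 1)) 1 + z 1 ≤ cen' 1 + b₀ 1 - 2
      rw [pt_one]
      have : f₁ + X1hi + 1 ≤ cen' 1 + b₀ 1 - 2 - z 1 := le_of_mul_le_mul_left (by simp only [X1hi]; linarith) hmod0
      linarith

end Skelφ

end Summit.CriticalPhenomena.PercolationContinuityZ3.Theorems.Transplant
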